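import Summits.BirchSwinnertonDyer.BirchSwinnertonDyer.Theorems.AlignedTransportAtTwoMainConjectureOfRankZeroBSDAtTwoSeed
import Summits.BirchSwinnertonDyer.BirchSwinnertonDyer.Theorems.ByReductionTypeAtTwoTowerClass1727a
import HarnessLib

/-!
# Route `AlignedTransportAtTwo`, crux C2 `MainConjectureOfRankZeroBSDAtTwo` (stmt-BirchSwinnertonDyer-22298):
# the TURNKEY (γ) RE-GLUE — the leaf from C1 + C3′ + the strengthened residual R″ with NO seed conjecture —
# and the REPAIRED seed statement C2′ AT the certified thin-cell′ seeds

HONEST FRAMING (cell `bsd-f1-sign2`, HOME `run/shared/lean/pub/bsd-f1-sign2/`, prover seat `bsd-line-att-p4`, line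
`birth` of the crux; BSD is NOT proved by any of this). THEOREMS ONLY — no definition, no named fact, nothing
asserted. The lead prover (`bsd-line-att-p2`, p583329) showed that MODULO PRINT the crux C2 is EQUIVALENT to
Greenberg's `μ = 0` conjecture at `p = 2` on the seed cell (`AlignedTransportAtTwoSeed.mainConjectureOfRankZeroBSDAtTwo_iff_seedMuZero`,
OPEN) and that the REPAIRED statement C2′ = «C2 restricted to seeds carrying the per-curve `μ₂ = 0` certificate
`X5.O1.TowerGapAtTwo W′`» is a THEOREM modulo PRINT (`…_certified`). This file makes the planner-of-record's
TURNKEY (γ) concrete and kernel-checked: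

* §1 `closes_certified` — the route's deciding composition with C2 REPLACED by C2′ and the declared residual R
  (`OffAlignedSeedCellAtTwo`) by R″ (the same statement whose excluded cell additionally asks the seed `W′` to
  carry `TowerGapAtTwo W′`): `C1 → C2′ → C3′ → R″ → WAllNonCMAtTwoOffThetaHabitat`. Hence
  `leaf_of_print_of_transport_descent_residual` — MODULO PRINT {Kato 17.4 (1)(2) at `2`, Greenberg 4.1,
  the period unit at `2`, modularity, GZK} the leaf needs ONLY C1 (stmt-22296), C3′ (stmt-23008) and R″: the
  seed conjecture C2 is ELIMINATED from the route at the price of moving the targets of uncertified seeds into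
  the residual (`offAlignedSeedCellAtTwo_of_residualCertified`: R″ ⟹ R, i.e. R″ is the stronger residual; the
  difference R″ ∖ R is exactly «cell curves all of whose aligned seeds lack a tower-gap certificate»).
* §2 C2′ AT THE SEEDS — for each thin-cell′ seed certified by D-imc-12 (kit j293825, engine A; per-seed
  parameters `MEMO-imc-data/dimc12/j293825/TURNKEY-SEEDS-v2.json`), Mazur's `2`-adic main conjecture for the
  seed from PRINT + `r_an = 0` + `BSD₂(seed)` + the seed's tower-gap certificate (route-independent class files
  `Theorems/ByReductionTypeAtTwoTowerClass<seed>.lean`), and with every binder displayed (the two layer Selmer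
  counts of the `univM` door; the layer-`3` count is GRH-conditional per the E1 convention and is a HYPOTHESIS,
  not a kernel fact). Seeds are appended to this file as their class files land.

References: K. Kato, Astérisque 295 (2004), Thm. 17.4; R. Greenberg, LNM 1716 (1999), §3, Thm. 4.1, Conj. 1.11;
A. Abbes, E. Ullmo, Compositio 103 (1996), Thm. A; L. Washington, GTM 83, §13.2; R. L. Miller, LMS J. Comput.
Math. 14 (2011), Def. 1.1.
-/

set_option autoImplicit false

noncomputable section

open scoped Classical MatrixGroups ModularForm

open CongruenceSubgroup WeierstrassCurve Literature.NumberTheory.EllipticCurves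
  Literature.NumberTheory.EllipticCurves.ModularForms
  Literature.NumberTheory.EllipticCurves.Rank1Residual
  Literature.NumberTheory.EllipticCurves.Rank1Residual.Typed
  Literature.NumberTheory.EllipticCurves.Greenberg1999
  Summit.BirchSwinnertonDyer.Rank1Residual
  Summit.BirchSwinnertonDyer.Rank1Residual.X1.MuLambda
  Summit.BirchSwinnertonDyer.Rank1Residual.X5 Summit.BirchSwinnertonDyer.Rank1Residual.X5.O1
  Summit.BirchSwinnertonDyer.Rank1Residual.F1Sign2
  Summit.BirchSwinnertonDyer.BirchSwinnertonDyer.Theorems.Rank1ResidualX1Defs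
  Summit.BirchSwinnertonDyer.BirchSwinnertonDyer.Theses.AlignedTransportAtTwo
  Summit.BirchSwinnertonDyer.BirchSwinnertonDyer.Theorems.TowerClass

namespace Summit.BirchSwinnertonDyer.BirchSwinnertonDyer.Theorems.AlignedTransportAtTwoCertifiedSeeds

/-! ## §1 The (γ) re-glue: the leaf from C1, C2′, C3′ and the strengthened residual R″ -/

/-- **R″ ⟹ R**: the strengthened residual (cell seeds must ALSO carry `TowerGapAtTwo W′`) implies the route's
declared residual `OffAlignedSeedCellAtTwo` verbatim — a curve off the original cell is off the smaller certified
cell. (So the (γ) re-glue trades the seed conjecture C2 for a LARGER residual, honestly.) [folklore] -/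
theorem offAlignedSeedCellAtTwo_of_residualCertified
    (hR'' : ∀ (W : WeierstrassCurve ℚ) [W.IsElliptic] [W.IsGloballyMinimal], ¬ W.HasCM → W.analyticRank ≤ 1 →
      ¬ (W.analyticRank = 0 ∧ GoodSS W 2 ∧ W.frobeniusTrace 2 = 0 ∧
          ∃ (A : WeierstrassCurve ℚ) (_ : A.IsElliptic) (_ : A.IsGloballyMinimal),
            A.HasCM ∧ A.analyticRank = 0 ∧ GoodSS A 2 ∧ A.frobeniusTrace 2 = 0 ∧
              ∃ e : WeierstrassCurve.geomTorsion W (2 : ℤ) ≃+ WeierstrassCurve.geomTorsion A (2 : ℤ),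
                ∀ (σ : Field.absoluteGaloisGroup ℚ) (P : WeierstrassCurve.geomTorsion W (2 : ℤ)),
                  e (σ • P) = σ • e P) →
      ¬ (W.analyticRank = 1 ∧ IsOrdinaryAt W 2 ∧ (∀ x : ℚ, ¬ HasRationalTwoTorsionX W x) ∧ ¬ IsSquare W.Δ ∧
          (∀ [NeZero (W.conductorNorm ℤ)] (f : CuspForm (Gamma0 (W.conductorNorm ℤ)) 2), IsNewformOf W f →
            (padicLFunction f (unitRoot W 2 : ℚ_[2])).order = 1) ∧
          ∃ (W' : WeierstrassCurve ℚ) (_ : W'.IsElliptic) (_ : W'.IsGloballyMinimal),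
            ¬ W'.HasCM ∧ IsOrdinaryAt W' 2 ∧ (∀ x : ℚ, ¬ HasRationalTwoTorsionX W' x) ∧ ¬ IsSquare W'.Δ ∧
              W'.analyticRank = 0 ∧ BSDp W' 2 ∧ O1.TowerGapAtTwo W' ∧
              (∀ ⦃N' : ℕ⦄ [NeZero N'] (f' : CuspForm (Gamma0 N') 2), IsNewformOf W' f' →
                ∀ G' : IwasawaAlgebra 2, IsEvenBranchLiftAtTwo W' f' G' → red G' ≠ 0) ∧
              ∃ (F : Type) (_ : Field F) (_ : NumberField F), Module.finrank ℚ F = 3 ∧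
                ∃ e' e : F, Polynomial.aeval e' (twoDivisionUCubic W') = 0 ∧
                  Polynomial.aeval e (twoDivisionUCubic W) = 0 ∧ AlignedAtTwo F e' e ∧
                  AlignedAtInfinity F (twoDivisionUCubic W') (twoDivisionUCubic W) e' e) →
      BSDp W 2) :
    OffAlignedSeedCellAtTwo := by
  intro W _ _ hcm hr hoff hc
  refine hR'' W hcm hr hoff ?_
  rintro ⟨hr1, hord, ht, hsq, hSZ, W', i1, i2, hcm', hord', ht', hsq', hr0', hbsd', -, hmu', F, iF, iNF, hF,
    e', e, he', he, hal, hali⟩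
  exact hc ⟨hr1, hord, ht, hsq, hSZ, W', i1, i2, hcm', hord', ht', hsq', hr0', hbsd', hmu', F, iF, iNF, hF,
    e', e, he', he, hal, hali⟩

/-- **The (γ) RE-GLUE, kernel-checked.** The route's deciding composition with the seed conjecture C2 replaced
by the REPAIRED seed statement C2′ (C2 + the per-seed `μ₂ = 0` certificate `X5.O1.TowerGapAtTwo W′`; the type of
p583329 `AlignedTransportAtTwoSeed.mainConjectureOfRankZeroBSDAtTwo_certified`) and the declared residual by R″
(the excluded cell additionally requires `TowerGapAtTwo W′` of the seed): C1 → C2′ → C3′ → R″ → the leaf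
`WAllNonCMAtTwoOffThetaHabitat`. On the certified cell: the seed `W′` gets Mazur's `2`-adic main conjecture from
C2′, `W` gets it by the aligned transport C1, and C3′ turns it into `BSD(W,2)`; off it, R″. [folklore] -/
theorem closes_certified (h1 : MainConjectureTransportAlignedAtTwo)
    (h2' : ∀ (W : WeierstrassCurve ℚ) [W.IsElliptic] [W.IsGloballyMinimal], ¬ W.HasCM →
      IsOrdinaryAt W 2 → (∀ x : ℚ, ¬ HasRationalTwoTorsionX W x) → ¬ IsSquare W.Δ →
      W.analyticRank = 0 →
      (∀ ⦃N : ℕ⦄ [NeZero N] (f : CuspForm (Gamma0 N) 2), IsNewformOf W f →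
        ∀ G : IwasawaAlgebra 2, IsEvenBranchLiftAtTwo W f G → red G ≠ 0) →
      BSDp W 2 → O1.TowerGapAtTwo W → MazurMainConjecture W 2)
    (h3 : BSDOfMainConjectureRankOneAtTwo)
    (hR'' : ∀ (W : WeierstrassCurve ℚ) [W.IsElliptic] [W.IsGloballyMinimal], ¬ W.HasCM → W.analyticRank ≤ 1 →
      ¬ (W.analyticRank = 0 ∧ GoodSS W 2 ∧ W.frobeniusTrace 2 = 0 ∧
          ∃ (A : WeierstrassCurve ℚ) (_ : A.IsElliptic) (_ : A.IsGloballyMinimal),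
            A.HasCM ∧ A.analyticRank = 0 ∧ GoodSS A 2 ∧ A.frobeniusTrace 2 = 0 ∧
              ∃ e : WeierstrassCurve.geomTorsion W (2 : ℤ) ≃+ WeierstrassCurve.geomTorsion A (2 : ℤ),
                ∀ (σ : Field.absoluteGaloisGroup ℚ) (P : WeierstrassCurve.geomTorsion W (2 : ℤ)),
                  e (σ • P) = σ • e P) →
      ¬ (W.analyticRank = 1 ∧ IsOrdinaryAt W 2 ∧ (∀ x : ℚ, ¬ HasRationalTwoTorsionX W x) ∧ ¬ IsSquare W.Δ ∧
          (∀ [NeZero (W.conductorNorm ℤ)] (f : CuspForm (Gamma0 (W.conductorNorm ℤ)) 2), IsNewformOf W f →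
            (padicLFunction f (unitRoot W 2 : ℚ_[2])).order = 1) ∧
          ∃ (W' : WeierstrassCurve ℚ) (_ : W'.IsElliptic) (_ : W'.IsGloballyMinimal),
            ¬ W'.HasCM ∧ IsOrdinaryAt W' 2 ∧ (∀ x : ℚ, ¬ HasRationalTwoTorsionX W' x) ∧ ¬ IsSquare W'.Δ ∧
              W'.analyticRank = 0 ∧ BSDp W' 2 ∧ O1.TowerGapAtTwo W' ∧
              (∀ ⦃N' : ℕ⦄ [NeZero N'] (f' : CuspForm (Gamma0 N') 2), IsNewformOf W' f' →
                ∀ G' : IwasawaAlgebra 2, IsEvenBranchLiftAtTwo W' f' G' → red G' ≠ 0) ∧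
              ∃ (F : Type) (_ : Field F) (_ : NumberField F), Module.finrank ℚ F = 3 ∧
                ∃ e' e : F, Polynomial.aeval e' (twoDivisionUCubic W') = 0 ∧
                  Polynomial.aeval e (twoDivisionUCubic W) = 0 ∧ AlignedAtTwo F e' e ∧
                  AlignedAtInfinity F (twoDivisionUCubic W') (twoDivisionUCubic W) e' e) →
      BSDp W 2) :
    Summit.BirchSwinnertonDyer.WAllNonCMAtTwoOffThetaHabitat := by
  intro W _ _ hcm hr hoff
  by_cases hc : (W.analyticRank = 1 ∧ IsOrdinaryAt W 2 ∧ (∀ x : ℚ, ¬ HasRationalTwoTorsionX W x) ∧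
      ¬ IsSquare W.Δ ∧
      (∀ [NeZero (W.conductorNorm ℤ)] (f : CuspForm (Gamma0 (W.conductorNorm ℤ)) 2), IsNewformOf W f →
        (padicLFunction f (unitRoot W 2 : ℚ_[2])).order = 1) ∧
      ∃ (W' : WeierstrassCurve ℚ) (_ : W'.IsElliptic) (_ : W'.IsGloballyMinimal),
        ¬ W'.HasCM ∧ IsOrdinaryAt W' 2 ∧ (∀ x : ℚ, ¬ HasRationalTwoTorsionX W' x) ∧ ¬ IsSquare W'.Δ ∧
          W'.analyticRank = 0 ∧ BSDp W' 2 ∧ O1.TowerGapAtTwo W' ∧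
          (∀ ⦃N' : ℕ⦄ [NeZero N'] (f' : CuspForm (Gamma0 N') 2), IsNewformOf W' f' →
            ∀ G' : IwasawaAlgebra 2, IsEvenBranchLiftAtTwo W' f' G' → red G' ≠ 0) ∧
          ∃ (F : Type) (_ : Field F) (_ : NumberField F), Module.finrank ℚ F = 3 ∧
            ∃ e' e : F, Polynomial.aeval e' (twoDivisionUCubic W') = 0 ∧
              Polynomial.aeval e (twoDivisionUCubic W) = 0 ∧ AlignedAtTwo F e' e ∧
              AlignedAtInfinity F (twoDivisionUCubic W') (twoDivisionUCubic W) e' e)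
  · obtain ⟨hr1, hord, ht, hsq, hSZ, W', i1, i2, hcm', hord', ht', hsq', hr0', hbsd', hgap', hmu', F, iF, iNF,
      hF, e', e, he', he, hal, hali⟩ := hc
    exact h3 W hcm hord ht hsq hr1 hSZ
      (h1 W' W hord' hord ht' ht hsq F hF e' e he' he hal hali hmu'
        (h2' W' hcm' hord' ht' hsq' hr0' hmu' hbsd' hgap'))
  · exact hR'' W hcm hr hoff hc

/-- **MODULO PRINT THE LEAF NEEDS NO SEED CONJECTURE.** Granted PRINT — Kato 17.4 (1)(2) at `2` for every curve
(`h17`), Greenberg Thm. 4.1 parity-free (`hGr`), the period unit at `2` (`hper`), modularity (`hmod`),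
Gross–Zagier–Kolyvagin (`hGZK`) — the registered leaf `WAllNonCMAtTwoOffThetaHabitat` follows from the aligned
transport C1 (stmt-BirchSwinnertonDyer-22296), the rank-one descent C3′ (stmt-BirchSwinnertonDyer-23008) and the
strengthened residual R″ ALONE: C2′ is p583329's theorem `mainConjectureOfRankZeroBSDAtTwo_certified`. This is the
planner-of-record's TURNKEY (γ) «re-glue with C2′ + R″», as a kernel fact for the route decision.
[cite: Kato2004Asterisque, Thm. 17.4 (1)(2) (p. 273)] [cite: GreenbergLNM1716, Thm. 4.1 (p. 102)] [cite: AbbesUllmo1996, Thm. A]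
[cite: Washington1997, §13.2] -/
theorem leaf_of_print_of_transport_descent_residual
    (h17 : ∀ (V : WeierstrassCurve ℚ) [V.IsElliptic] [V.IsGloballyMinimal] [NeZero (V.conductorNorm ℤ)]
      (f : CuspForm (Gamma0 (V.conductorNorm ℤ)) 2), kato_divisibility_allPrimes V 2 (f := f))
    (hGr : Greenberg1999.thm41_charValue_rankZero_anyPrime)
    (hper : realPeriodRat_eq_unit_mul_plusPeriod_two) (hmod : nonempty_modularParametrizationData)
    (hGZK : rank_eq_analyticRank_of_analyticRank_le_one)
    (h1 : MainConjectureTransportAlignedAtTwo) (h3 : BSDOfMainConjectureRankOneAtTwo)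
    (hR'' : ∀ (W : WeierstrassCurve ℚ) [W.IsElliptic] [W.IsGloballyMinimal], ¬ W.HasCM → W.analyticRank ≤ 1 →
      ¬ (W.analyticRank = 0 ∧ GoodSS W 2 ∧ W.frobeniusTrace 2 = 0 ∧
          ∃ (A : WeierstrassCurve ℚ) (_ : A.IsElliptic) (_ : A.IsGloballyMinimal),
            A.HasCM ∧ A.analyticRank = 0 ∧ GoodSS A 2 ∧ A.frobeniusTrace 2 = 0 ∧
              ∃ e : WeierstrassCurve.geomTorsion W (2 : ℤ) ≃+ WeierstrassCurve.geomTorsion A (2 : ℤ),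
                ∀ (σ : Field.absoluteGaloisGroup ℚ) (P : WeierstrassCurve.geomTorsion W (2 : ℤ)),
                  e (σ • P) = σ • e P) →
      ¬ (W.analyticRank = 1 ∧ IsOrdinaryAt W 2 ∧ (∀ x : ℚ, ¬ HasRationalTwoTorsionX W x) ∧ ¬ IsSquare W.Δ ∧
          (∀ [NeZero (W.conductorNorm ℤ)] (f : CuspForm (Gamma0 (W.conductorNorm ℤ)) 2), IsNewformOf W f →
            (padicLFunction f (unitRoot W 2 : ℚ_[2])).order = 1) ∧
          ∃ (W' : WeierstrassCurve ℚ) (_ : W'.IsElliptic) (_ : W'.IsGloballyMinimal),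
            ¬ W'.HasCM ∧ IsOrdinaryAt W' 2 ∧ (∀ x : ℚ, ¬ HasRationalTwoTorsionX W' x) ∧ ¬ IsSquare W'.Δ ∧
              W'.analyticRank = 0 ∧ BSDp W' 2 ∧ O1.TowerGapAtTwo W' ∧
              (∀ ⦃N' : ℕ⦄ [NeZero N'] (f' : CuspForm (Gamma0 N') 2), IsNewformOf W' f' →
                ∀ G' : IwasawaAlgebra 2, IsEvenBranchLiftAtTwo W' f' G' → red G' ≠ 0) ∧
              ∃ (F : Type) (_ : Field F) (_ : NumberField F), Module.finrank ℚ F = 3 ∧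
                ∃ e' e : F, Polynomial.aeval e' (twoDivisionUCubic W') = 0 ∧
                  Polynomial.aeval e (twoDivisionUCubic W) = 0 ∧ AlignedAtTwo F e' e ∧
                  AlignedAtInfinity F (twoDivisionUCubic W') (twoDivisionUCubic W) e' e) →
      BSDp W 2) :
    Summit.BirchSwinnertonDyer.WAllNonCMAtTwoOffThetaHabitat :=
  closes_certified h1 (AlignedTransportAtTwoSeed.mainConjectureOfRankZeroBSDAtTwo_certified h17 hGr hper hmod hGZK)
    h3 hR''

/-- **The ORIGINAL glue factors through the certified one on the C2 side**: C2 (as filed) implies C2′ (drop the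
certificate). So `closes_certified` asks LESS of the seed leg and MORE of the residual than `closes`. [folklore] -/
theorem seedCertified_of_mainConjectureOfRankZeroBSDAtTwo (h2 : MainConjectureOfRankZeroBSDAtTwo) :
    ∀ (W : WeierstrassCurve ℚ) [W.IsElliptic] [W.IsGloballyMinimal], ¬ W.HasCM →
      IsOrdinaryAt W 2 → (∀ x : ℚ, ¬ HasRationalTwoTorsionX W x) → ¬ IsSquare W.Δ →
      W.analyticRank = 0 →
      (∀ ⦃N : ℕ⦄ [NeZero N] (f : CuspForm (Gamma0 N) 2), IsNewformOf W f →
        ∀ G : IwasawaAlgebra 2, IsEvenBranchLiftAtTwo W f G → red G ≠ 0) →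
      BSDp W 2 → O1.TowerGapAtTwo W → MazurMainConjecture W 2 :=
  fun W _ _ hcm hord ht hsq hr hμ hbsd _ => h2 W hcm hord ht hsq hr hμ hbsd

/-! ## §2 C2′ AT THE CERTIFIED SEEDS (D-imc-12, kit j293825; TURNKEY-SEEDS-v2.json) -/

/-! ### Seed `1727a1` (layer pair (0,3); D-imc-12: `a = 0`, `d = 2`, `Σ = 0`, slack 3) -/

/-- **C2′ AT THE SEED `1727a1`**: Mazur's `2`-adic main conjecture for `1727a1` from PRINT {`h17`, `hGr`, `hper`, `hmod`,
`hGZK`} + `r_an = 0` + `BSD₂(1727a1)` (the route's transported input) + the tower-gap certificate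
`TowerGapAtTwo c1727a1` (class file `Theorems/ByReductionTypeAtTwoTowerClass1727a.lean`), through p583329
`AlignedTransportAtTwoSeed.mazurMainConjecture_two_of_bsdp_of_towerGap`; the cell binders good-ordinary-at-`2` and
«no rational `2`-torsion abscissa» are kernel-decided in the class file. [cite: Kato2004Asterisque, Thm. 17.4 (1)(2) (p. 273)]
[cite: GreenbergLNM1716, Thm. 4.1 (p. 102)] [cite: AbbesUllmo1996, Thm. A] -/
theorem mazurMainConjecture_two_1727a1_of_bsdp
    (h17 : ∀ [NeZero (c1727a1.conductorNorm ℤ)] (f : CuspForm (Gamma0 (c1727a1.conductorNorm ℤ)) 2),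
      kato_divisibility_allPrimes c1727a1 2 (f := f))
    (hGr : Greenberg1999.thm41_charValue_rankZero_anyPrime)
    (hper : realPeriodRat_eq_unit_mul_plusPeriod_two)
    (hmod : nonempty_modularParametrizationData) (hGZK : rank_eq_analyticRank_of_analyticRank_le_one)
    (hr : c1727a1.analyticRank = 0) (hbsd : BSDp c1727a1 2) (hgap : TowerGapAtTwo c1727a1) :
    MazurMainConjecture c1727a1 2 :=
  AlignedTransportAtTwoSeed.mazurMainConjecture_two_of_bsdp_of_towerGap c1727a1 h17 hGr hper hmod hGZK
    goodOrd_two_1727a1 not_hasRationalTwoTorsionX_1727a1 hr hbsd hgap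

/-- **C2′ AT THE SEED `1727a1`, every binder displayed**: PRINT {`h17`, `hGr`, `hper`, `hmod`, `hGZK`, `hS34`} +
`r_an = 0` + `BSD₂(1727a1)` + the two layer counts of the `univM` door at the pair `(0,3)` with the D-imc-12
numerals (`2^0 ≤ #Sel_{2^∞}(E/ℚ_0)[2]`, `#Sel_{2^∞}(E/ℚ_3)[2] ≤ 2^2`; kit j293825 engine A, GRH-conditional at
`j' = 3` per the E1 convention). [cite: GreenbergLNM1716, §3 Lemmas 3.3–3.5, Prop. 2.5, Thm. 4.1] [cite: Kato2004Asterisque, Thm. 17.4 (1)(2)] -/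
theorem mazurMainConjecture_two_1727a1_certified
    (h17 : ∀ [NeZero (c1727a1.conductorNorm ℤ)] (f : CuspForm (Gamma0 (c1727a1.conductorNorm ℤ)) 2),
      kato_divisibility_allPrimes c1727a1 2 (f := f))
    (hGr : Greenberg1999.thm41_charValue_rankZero_anyPrime)
    (hper : realPeriodRat_eq_unit_mul_plusPeriod_two)
    (hmod : nonempty_modularParametrizationData) (hGZK : rank_eq_analyticRank_of_analyticRank_le_one)
    (hS34 : lemma34_localTowerKerPrimary_cyclicExtension_rat)
    (hr : c1727a1.analyticRank = 0) (hbsd : BSDp c1727a1 2)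
    (hlow : ∀ κ : ZpExtension ℚ 2, κ.IsCyclotomic →
      2 ^ 0 ≤ Nat.card {z : c1727a1.selmerLayer κ 0 // 2 • z = 0})
    (hup : ∀ κ : ZpExtension ℚ 2, κ.IsCyclotomic →
      Nat.card {z : c1727a1.selmerLayer κ 3 // 2 • z = 0} ≤ 2 ^ 2) : MazurMainConjecture c1727a1 2 :=
  mazurMainConjecture_two_1727a1_of_bsdp h17 hGr hper hmod hGZK hr hbsd
    (towerGapAtTwo_1727a1_l03M hS34 hlow hup (by norm_num))

/-- **C2′ AT THE SEED `1727a1` with ONE numerical input**: as `mazurMainConjecture_two_1727a1_certified` with the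
layer-`0` lower count DISCHARGED (`2^0 ≤ #Sel_{2^∞}(E/ℚ)[2]`: finiteness + `0 ∈`, tree
`KatoHalfPinch.one_le_natCard_selmerLayer_twoTorsion`); the only engine datum left is `#Sel_{2^∞}(E/ℚ(ζ₃₂)⁺)[2] ≤ 2^2`
(D-imc-12 `d₃ = 2`, GRH-conditional per the E1 convention). The other eleven certified seeds are in the companion
files `AlignedTransportAtTwoCertifiedSeedsB.lean` / `…C.lean`. [cite: GreenbergLNM1716, §3 Lemmas 3.1, 3.3–3.5, Prop. 2.5, Thm. 4.1]
[cite: Kato2004Asterisque, Thm. 17.4 (1)(2)] -/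
theorem mazurMainConjecture_two_1727a1_certified₀
    (h17 : ∀ [NeZero (c1727a1.conductorNorm ℤ)] (f : CuspForm (Gamma0 (c1727a1.conductorNorm ℤ)) 2),
      kato_divisibility_allPrimes c1727a1 2 (f := f))
    (hGr : Greenberg1999.thm41_charValue_rankZero_anyPrime)
    (hper : realPeriodRat_eq_unit_mul_plusPeriod_two)
    (hmod : nonempty_modularParametrizationData) (hGZK : rank_eq_analyticRank_of_analyticRank_le_one)
    (hS34 : lemma34_localTowerKerPrimary_cyclicExtension_rat)
    (hr : c1727a1.analyticRank = 0) (hbsd : BSDp c1727a1 2)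
    (hup : ∀ κ : ZpExtension ℚ 2, κ.IsCyclotomic →
      Nat.card {z : c1727a1.selmerLayer κ 3 // 2 • z = 0} ≤ 2 ^ 2) : MazurMainConjecture c1727a1 2 :=
  mazurMainConjecture_two_1727a1_of_bsdp h17 hGr hper hmod hGZK hr hbsd
    (towerGapAtTwo_1727a1_l03M hS34
      (fun κ _ ↦ KatoHalfPinch.one_le_natCard_selmerLayer_twoTorsion c1727a1 not_two_dvd_torsionOrder_1727a1 κ 0)
      hup (by norm_num))

end Summit.BirchSwinnertonDyer.BirchSwinnertonDyer.Theorems.AlignedTransportAtTwoCertifiedSeeds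

end
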